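import Literature.Probability.RandomPlanarGeometry.SAWStripPolygonLowerBound
import Literature.Probability.RandomPlanarGeometry.SAWLadderGoldenMean
import HarnessLib

/-!
# Certified bounds for polygon growth constants of narrow strips: `π(ℤ×{0,1,2}) ≤ φ ≤ π(ℤ×{0,1,2,3})`

Topic `Literature/Probability/RandomPlanarGeometry` (continues `SAWStripPolygonWallBound.lean`: `π(S_T) ≤ μ(S_{T-1})`;
`SAWStripPolygonLowerBound.lean`: `μ(S_h) ≤ π(S_{2h+1})`; `SAWLadderGoldenMean.lean`: `μ(ℤ × {0,1}) = φ = (1+√5)/2`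
(Alm–Janson 1990; Grimmett–Li 2015)). Instances: the growth rate of the self-avoiding polygons of the strip with three
rows is at most the golden mean, and that of the strip with four rows is at least the golden mean (the printed values,
from the rational generating functions of §10.1 p. 237, are `1.414213562` (= `√2`) and `1.681759003`, to 9 decimals:
A. J. Guttmann, I. Jensen, LNP 775 ch. 10, Table 10.1, pp. 237–238 — a CONSOLIDATION of the two lane bounds against
printed constants).
-/

noncomputable section

open Real

namespace Literature.Probability.RandomPlanarGeometry.SAW.Zd

/-- **`π(ℤ × {0,1,2}) ≤ φ`**: polygons in the three-row strip grow at most like the golden mean (`π(S_2) ≤ μ(S_1) = φ`;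
the exact value is `√2`). [cite: MadrasSlade1993, Theorem 8.2.2 (b) (pp. 270–271; numeric instance via this lane's wall bound)]
[cite: GuttmannJensen2009Confinement, Table 10.1, pp. 237–238 (d = 3: μ_3(square) = 1.414213562, printed to 9 decimals; = √2 by the width-2 rational generating function, §10.1 p. 237)] -/
theorem tubePolygonRate_two_le_goldenRatio : tubePolygonRate 2 1 2 ≤ goldenRatio := by
  have h := tubePolygonRate_le_tubeConnectiveConstant_pred (T := 2) (by norm_num)
  rwa [show (2 - 1 : ℕ) = 1 from rfl, Ladder.tubeConnectiveConstant_ladder] at h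

/-- **`φ ≤ π(ℤ × {0,1,2,3})`**: polygons in the four-row strip grow at least like the golden mean (`μ(S_1) = φ ≤ π(S_3)`;
the printed value is `1.681759003`). [cite: MadrasSlade1993, Theorem 8.2.2 (pp. 270–271; numeric instance via this lane's lower bound)]
[cite: GuttmannJensen2009Confinement, Table 10.1, pp. 237–238 (d = 4: μ_4(square) = 1.681759003, printed to 9 decimals)] -/
theorem goldenRatio_le_tubePolygonRate_three : goldenRatio ≤ tubePolygonRate 2 1 3 := by
  have h := tubeConnectiveConstant_le_tubePolygonRate_double 1
  rwa [Ladder.tubeConnectiveConstant_ladder] at h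

end Literature.Probability.RandomPlanarGeometry.SAW.Zd

end
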